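import Summits.ABC.StewartYu.PadicTwoRecordNumerics
import HarnessLib

/-!
# Cell abc-stewartyu, W80Two (crux stmt-ABC-19486): the parameter pack of the `2`-adic machine from the
# `q = 3` record and FIVE frame-side size statements

`Summits/ABC/StewartYu/PadicTwoRecordPack.lean` — cell `abc-stewartyu` (HOME
`run/shared/lean/pub/abc-stewartyu/`, seat p1-g5 = record owner; route `PadicPrimesW80TwoThirds`, crux
`W80Two`); one definition (`TwoSetup.paramPack3OfSizes`, a structure-valued constructor) and theorems, no
named fact.  Sequel to `PadicTwoRecordNumerics`: with the canonical clearing denominators `Dclear3_J`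
of p2-g3's `DescentIntegralityThirdQ` (integral on the cores, the third-point weights and `qTerm3`), the
fields `hsz`, `hthird`, `hsiegel` of p2-g3's `TwoSetup.ParamPack3` reduce to five SIZE statements —
`Dclear3_J ≤ DmaxK3 k` / `|coreSum3| ≤ MmaxK3 k` (inner steps), `Dclear3_J ≤ DmaxT3` /
`Σᵤ P·|qΔ3·qA·qEt| ≤ MmaxT3` (third step, IN RANGE `s < 3^{J+1}S₀`, `3 ∤ s`, `|τ| < T/3^{J+1}` only) and
`|Dclear3₀·qTerm3| ≤ Amax3` (Siegel) — which the frame-side sizes layer (`PadicW80Sizes3C`, seat p5)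
proves under `hy : SizeHyp V V_θ W`; `paramPack3OfSizes` is then the whole pack (half multiplicity
`⌊t_J/2⌋`, integer bound `⌈#box3₀ · Amax3⌉`) and `norm_Λ₀_gt_of_sizes3` the `2`-adic lower bound
`‖Λ₀‖₂ > e^{−U}`. [cite: Yu1989, §3] [cite: Waldschmidt1980, §§3.2–3.5 (pp. 264–274)]
-/

noncomputable section

open NormedSpace Finset IsUltrametricDist Real
open Literature.NumberTheory.Transcendental
open Literature.NumberTheory.Transcendental.CW77.Setup (Idx Tau tauNorm tauSet)
open Literature.NumberTheory.Transcendental.PadicCW77 (condExp)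
open scoped Nat

namespace Summit.ABC.StewartYu

namespace TwoSetup

variable (S : TwoSetup) (P : PadicW80ParL S.d)

/-! ### The pack from the frame-side SIZE statements only (range-restricted size bounds)

`thirdStep_of_record` above (like `thirdStep_of_log_ineq`) asks `D ≤ DmaxT3`, `Mb ≤ MmaxT3` for ALL
`(s,τ)`, which no clearing denominator satisfies; the versions below ask them only IN RANGE
(`s < 3^{J+1} S₀`, `3 ∤ s`, `|τ| < T/3^{J+1}`), which is all `thirdStep_of_numerics` uses, and fix the
canonical data `D := Dclear3_J` (p2-g3's `DescentIntegralityThirdQ`), `Mb := max MmaxT3 (actual sum)`. -/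

/-- **The third step at level `J`, size bounds IN RANGE only** (any `D`, `Mb` with integrality /
majorisation everywhere). [cite: Yu1989, §3 Lemmas 3.4–3.5] -/
theorem thirdStep_of_record' (hℓ1 : P.ℓ = 1) {J : ℕ} (hJ : J < P.J₀3)
    (hΛ : ‖S.Λ₀‖ ≤ Real.exp (-P.Uℓ)) (hy : S.toQ.flat.SizeHyp P.V P.Vθ P.W)
    (hint : ∀ i, ∃ a : ℤ, S.toQ.all i = a)
    (hind : ∀ κ : Fin (S.d + 1) → ℕ, (∃ j, ¬ 3 ∣ κ j) → ∀ γ : ℚ, ∏ j, S.toQ.all j ^ κ j ≠ γ ^ 3)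
    {Pint : ℤ} (D : ℕ → Tau S.d → ℕ) (hD : ∀ s τ, 1 ≤ D s τ)
    (hDc : ∀ s (τ : Tau S.d), ∀ u ∈ S.toQ.box3 (h := P.hparℓ) (Lb := P.Lb3) P.L3 P.Lθ3 J,
      ∃ z : ℤ, (D s τ : ℚ) *
        ((S.toQ.qΔ3 P.J₀3 (J + 1) u τ.1 s * S.frame.qA u τ.2) * S.toQ.qEt u s) = z)
    (Mb : ℕ → Tau S.d → ℝ) (hMb : ∀ s τ, 1 ≤ Mb s τ)
    (hMbP : ∀ s (τ : Tau S.d), ∑ u ∈ S.toQ.box3 (h := P.hparℓ) (Lb := P.Lb3) P.L3 P.Lθ3 J,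
      (Pint : ℝ) * |((S.toQ.qΔ3 P.J₀3 (J + 1) u τ.1 s * S.frame.qA u τ.2 * S.toQ.qEt u s : ℚ) : ℝ)| ≤
        Mb s τ)
    (hDle : ∀ s, s < 3 ^ (J + 1) * P.S₀3 → ¬ 3 ∣ s → ∀ τ : Tau S.d,
      tauNorm τ < P.T3 / 3 ^ (J + 1) → (D s τ : ℝ) ≤ P.DmaxT3)
    (hMle : ∀ s, s < 3 ^ (J + 1) * P.S₀3 → ¬ 3 ∣ s → ∀ τ : Tau S.d,
      tauNorm τ < P.T3 / 3 ^ (J + 1) → Mb s τ ≤ P.MmaxT3) :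
    S.ThirdStep (h := P.hparℓ) (Lb := P.Lb3) P.J₀3 J P.L3 P.Lθ3 P.S₀3 P.T3 (P.tJ3 J / 2) Pint := by
  have hHp1 := S.one_le_prod_max_one_abs_all
  have hHp0 : 0 < ∏ i, max 1 |(S.toQ.all i : ℝ)| := lt_of_lt_of_le one_pos hHp1
  have hHp := S.prod_max_one_abs_all_le P hy
  have h1 := P.third3_h1 hℓ1 hJ hHp1 hHp
  have h2 := P.third3_h2 hℓ1 hJ hHp1 hHp
  refine S.thirdStep_of_numerics hJ (P.one_le_tJ3_half hJ) (hΛ.trans P.exp_neg_U3_le)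
    (fun _ hτ => P.room3_of_half J hτ) hint hind D hD hDc Mb hMb hMbP fun s hs h3 τ hτ => ?_
  have hD0 : (0 : ℝ) < D s τ := by exact_mod_cast hD s τ
  have hM0 : 0 < Mb s τ := lt_of_lt_of_le one_pos (hMb s τ)
  have hfin := S.thirdFinal3_of_log_ineq (h := P.hparℓ) (Lb := P.Lb3) (3 ^ (S.d + J) * P.S₀3)
    (P.tJ3 J / 2) (3 ^ (S.d + 1 + 1) - 1) hΛ P.DmaxT3_pos P.MmaxT3_pos hHp0 h1 h2
  exact lt_of_lt_of_le hfin
    (SetupQ.thirdThreshold_anti hD0 (hDle s hs h3 τ hτ) hM0 (hMle s hs h3 τ hτ) hHp0 _)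

/-- **The third step at level `J` from the two frame-side sizes** with the canonical data
`D := Dclear3_J` (integral by `exists_int_Dclear3_mul_thirdWeight`) and `Mb := max MmaxT3 (Σᵤ P·|w|)`:
inputs `Dclear3_J(s,τ) ≤ DmaxT3` and `Σ_{u ∈ box3_J} P·|qΔ3_{J₀,J+1}·qA·qEt| ≤ MmaxT3` IN RANGE.
[cite: Yu1989, §3 Lemmas 3.4–3.5] -/
theorem thirdStep_of_sizes3 (hℓ1 : P.ℓ = 1) {J : ℕ} (hJ : J < P.J₀3)
    (hΛ : ‖S.Λ₀‖ ≤ Real.exp (-P.Uℓ)) (hy : S.toQ.flat.SizeHyp P.V P.Vθ P.W)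
    (hint : ∀ i, ∃ a : ℤ, S.toQ.all i = a)
    (hind : ∀ κ : Fin (S.d + 1) → ℕ, (∃ j, ¬ 3 ∣ κ j) → ∀ γ : ℚ, ∏ j, S.toQ.all j ^ κ j ≠ γ ^ 3)
    {Pint : ℤ}
    (hDle : ∀ s, s < 3 ^ (J + 1) * P.S₀3 → ¬ 3 ∣ s → ∀ τ : Tau S.d,
      tauNorm τ < P.T3 / 3 ^ (J + 1) →
        ((S.toQ.Dclear3 (h := P.hparℓ) J P.L3 P.Lθ3 s τ : ℕ) : ℝ) ≤ P.DmaxT3)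
    (hsum : ∀ s, s < 3 ^ (J + 1) * P.S₀3 → ¬ 3 ∣ s → ∀ τ : Tau S.d,
      tauNorm τ < P.T3 / 3 ^ (J + 1) →
        ∑ u ∈ S.toQ.box3 (h := P.hparℓ) (Lb := P.Lb3) P.L3 P.Lθ3 J,
          (Pint : ℝ) *
            |((S.toQ.qΔ3 P.J₀3 (J + 1) u τ.1 s * S.frame.qA u τ.2 * S.toQ.qEt u s : ℚ) : ℝ)| ≤
          P.MmaxT3) :
    S.ThirdStep (h := P.hparℓ) (Lb := P.Lb3) P.J₀3 J P.L3 P.Lθ3 P.S₀3 P.T3 (P.tJ3 J / 2) Pint := by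
  classical
  refine S.thirdStep_of_record' P hℓ1 hJ hΛ hy hint hind
    (fun s τ => S.toQ.Dclear3 (h := P.hparℓ) J P.L3 P.Lθ3 s τ)
    (fun s τ => S.toQ.Dclear3_pos J P.L3 P.Lθ3 s τ)
    (fun s τ u hu => S.toQ.exists_int_Dclear3_mul_thirdWeight P.J₀3 J hu τ s)
    (fun s τ => max P.MmaxT3 (∑ u ∈ S.toQ.box3 (h := P.hparℓ) (Lb := P.Lb3) P.L3 P.Lθ3 J,
      (Pint : ℝ) * |((S.toQ.qΔ3 P.J₀3 (J + 1) u τ.1 s * S.frame.qA u τ.2 * S.toQ.qEt u s : ℚ) : ℝ)|))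
    (fun s τ => le_max_of_le_left P.one_le_MmaxT3) (fun s τ => le_max_right _ _) hDle
    fun s hs h3 τ hτ => max_le le_rfl (hsum s hs h3 τ hτ)

/-- **The pack's field `hsz` from the two frame-side sizes of the inner steps**: with the canonical
denominator `Dclear3_J` (integral by `exists_int_Dclear3_mul_coreSum3`), inputs
`Dclear3_J(s₁,τ) ≤ DmaxK3 k` and `|coreSum3_{J,τ}(s₁)| ≤ MmaxK3 k` for `|τ| ≤ T`, `s₁ < 3^{k+1+J} S₀`.
[cite: Yu1989, §3 Lemma 3.3] [cite: Waldschmidt1980, §3.3 (p. 269)] -/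
theorem kSizes3_of_sizes3 {J : ℕ} (pv : Idx S.d P.hparℓ P.Lb3 → ℤ)
    (hDle : ∀ k, k < S.d → ∀ τ : Tau S.d, tauNorm τ ≤ P.T3 → ∀ s₁, s₁ < 3 ^ (k + 1 + J) * P.S₀3 →
      ((S.toQ.Dclear3 (h := P.hparℓ) J P.L3 P.Lθ3 s₁ τ : ℕ) : ℝ) ≤ P.DmaxK3 k)
    (hM : ∀ k, k < S.d → ∀ τ : Tau S.d, tauNorm τ ≤ P.T3 → ∀ s₁, s₁ < 3 ^ (k + 1 + J) * P.S₀3 →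
      ¬ 3 ∣ s₁ →
        |(S.toQ.coreSum3 P.J₀3 J (S.toQ.box3 (h := P.hparℓ) (Lb := P.Lb3) P.L3 P.Lθ3 J) pv τ s₁ : ℝ)| ≤
          P.MmaxK3 k) :
    S.KSizes3 P.J₀3 J P.L3 P.Lθ3 P.S₀3 P.T3 (P.tJ3 J / 2) pv P.DmaxK3 P.MmaxK3 := by
  intro k hk τ hτ s₁ hs₁ h3
  have hτT : tauNorm τ ≤ P.T3 := by
    have := Nat.div_le_self P.T3 (3 ^ J); omega
  exact ⟨_, S.toQ.Dclear3_pos J P.L3 P.Lθ3 s₁ τ, hDle k hk τ hτT s₁ hs₁,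
    S.toQ.exists_int_Dclear3_mul_coreSum3 P.J₀3 J P.L3 P.Lθ3 pv τ s₁, hM k hk τ hτT s₁ hs₁ h3⟩

/-- **The pack's field `hsiegel` from the one frame-side size at level `0`**: with `Dc := Dclear3₀`
(integral by `exists_int_Dclear3_mul_qTerm3`) and `Amax := Amax3`, input
`|Dclear3₀(s,τ) · qTerm3_{J₀,0}(u,τ,s)| ≤ Amax3` for `s < S₀`, `|τ| < T`, `u ∈ box3₀`.
[cite: Yu1989, §3 Lemma 3.1] -/
theorem siegel3_of_sizes3
    (hA : ∀ s, s < P.S₀3 → ¬ 3 ∣ s → ∀ τ : Tau S.d, tauNorm τ < P.T3 →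
      ∀ u ∈ S.toQ.box3 (h := P.hparℓ) (Lb := P.Lb3) P.L3 P.Lθ3 0,
        |((S.toQ.Dclear3 (h := P.hparℓ) 0 P.L3 P.Lθ3 s τ : ℕ) : ℝ) *
            (S.toQ.qTerm3 P.J₀3 0 u τ s : ℝ)| ≤ P.Amax3) :
    S.Siegel3 (h := P.hparℓ) (Lb := P.Lb3) P.J₀3 P.L3 P.Lθ3 P.S₀3 P.T3
      ⌈((S.toQ.box3 (h := P.hparℓ) (Lb := P.Lb3) P.L3 P.Lθ3 0).card : ℝ) * P.Amax3⌉ :=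
  S.siegel3_of_record P (fun s τ => S.toQ.Dclear3 (h := P.hparℓ) 0 P.L3 P.Lθ3 s τ)
    (fun s _ _ τ _ => S.toQ.Dclear3_pos 0 P.L3 P.Lθ3 s τ)
    (fun s _ _ τ _ _ hu => S.toQ.exists_int_Dclear3_mul_qTerm3 P.J₀3 0 hu τ s) P.one_le_Amax3 hA

/-- **The parameter pack of the `2`-adic machine at exponent `U` from the record and FIVE frame-side
size statements** (inner-step denominators and core sizes; third-step denominators and weight sums, in
range; Siegel's coefficient bound), for a set-up with integer generators satisfying the cube-Kummer
condition and the size hypotheses of the record: box `h = hparℓ`, `Lb = Lb3`, depth `J₀3`, ranges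
`L3, Lθ3`, `S₀3` points, `T3` derivatives, integer bound `⌈#box3₀ · Amax3⌉`, HALF multiplicity
`⌊t_J/2⌋`, sizes `DmaxK3, MmaxK3`. [cite: Yu1989, §3] [cite: Waldschmidt1980, §§3.2–3.5 (pp. 264–274)] -/
def paramPack3OfSizes (hℓ1 : P.ℓ = 1) (hy : S.toQ.flat.SizeHyp P.V P.Vθ P.W)
    (hint : ∀ i, ∃ a : ℤ, S.toQ.all i = a)
    (hind : ∀ κ : Fin (S.d + 1) → ℕ, (∃ j, ¬ 3 ∣ κ j) → ∀ γ : ℚ, ∏ j, S.toQ.all j ^ κ j ≠ γ ^ 3)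
    (hDK : ∀ J, J < P.J₀3 → ∀ k, k < S.d → ∀ τ : Tau S.d, tauNorm τ ≤ P.T3 →
      ∀ s₁, s₁ < 3 ^ (k + 1 + J) * P.S₀3 →
        ((S.toQ.Dclear3 (h := P.hparℓ) J P.L3 P.Lθ3 s₁ τ : ℕ) : ℝ) ≤ P.DmaxK3 k)
    (hMK : ∀ J, J < P.J₀3 → ∀ pv : Idx S.d P.hparℓ P.Lb3 → ℤ,
      (∀ u, |pv u| ≤ ⌈((S.toQ.box3 (h := P.hparℓ) (Lb := P.Lb3) P.L3 P.Lθ3 0).card : ℝ) * P.Amax3⌉) →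
      ∀ k, k < S.d → ∀ τ : Tau S.d, tauNorm τ ≤ P.T3 → ∀ s₁, s₁ < 3 ^ (k + 1 + J) * P.S₀3 →
        ¬ 3 ∣ s₁ →
          |(S.toQ.coreSum3 P.J₀3 J (S.toQ.box3 (h := P.hparℓ) (Lb := P.Lb3) P.L3 P.Lθ3 J) pv τ s₁ :
              ℝ)| ≤ P.MmaxK3 k)
    (hDT : ∀ J, J < P.J₀3 → ∀ s, s < 3 ^ (J + 1) * P.S₀3 → ¬ 3 ∣ s → ∀ τ : Tau S.d,
      tauNorm τ < P.T3 / 3 ^ (J + 1) →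
        ((S.toQ.Dclear3 (h := P.hparℓ) J P.L3 P.Lθ3 s τ : ℕ) : ℝ) ≤ P.DmaxT3)
    (hMT : ∀ J, J < P.J₀3 → ∀ s, s < 3 ^ (J + 1) * P.S₀3 → ¬ 3 ∣ s → ∀ τ : Tau S.d,
      tauNorm τ < P.T3 / 3 ^ (J + 1) →
        ∑ u ∈ S.toQ.box3 (h := P.hparℓ) (Lb := P.Lb3) P.L3 P.Lθ3 J,
          (⌈((S.toQ.box3 (h := P.hparℓ) (Lb := P.Lb3) P.L3 P.Lθ3 0).card : ℝ) * P.Amax3⌉ : ℝ) *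
            |((S.toQ.qΔ3 P.J₀3 (J + 1) u τ.1 s * S.frame.qA u τ.2 * S.toQ.qEt u s : ℚ) : ℝ)| ≤
          P.MmaxT3)
    (hA : ∀ s, s < P.S₀3 → ¬ 3 ∣ s → ∀ τ : Tau S.d, tauNorm τ < P.T3 →
      ∀ u ∈ S.toQ.box3 (h := P.hparℓ) (Lb := P.Lb3) P.L3 P.Lθ3 0,
        |((S.toQ.Dclear3 (h := P.hparℓ) 0 P.L3 P.Lθ3 s τ : ℕ) : ℝ) *
            (S.toQ.qTerm3 P.J₀3 0 u τ s : ℝ)| ≤ P.Amax3) :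
    S.ParamPack3 P.Uℓ where
  h := P.hparℓ
  Lb := P.Lb3
  J₀ := P.J₀3
  L := P.L3
  Lθ := P.Lθ3
  S₀ := P.S₀3
  T := P.T3
  P := ⌈((S.toQ.box3 (h := P.hparℓ) (Lb := P.Lb3) P.L3 P.Lθ3 0).card : ℝ) * P.Amax3⌉
  t := fun J => P.tJ3 J / 2
  Dmax := fun _ k => P.DmaxK3 k
  Mmax := fun _ k => P.MmaxK3 k
  ht := fun _ hJ => P.one_le_tJ3_half hJ
  hU8 := P.log_eight_le_U3
  hsz := fun J hJ pv inv => S.kSizes3_of_sizes3 P pv (hDK J hJ)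
    fun k hk τ hτ s₁ hs₁ h3 => hMK J hJ pv inv.bound k hk τ hτ s₁ hs₁ h3
  hfin := fun hΛ _ hJ => S.kFinal3_of_record P hℓ1 hΛ hJ
  hthird := fun hΛ J hJ => S.thirdStep_of_sizes3 P hℓ1 hJ hΛ hy hint hind (hDT J hJ) (hMT J hJ)
  hsiegel := S.siegel3_of_sizes3 P hA
  hend := S.endgame3_of_record P _

/-- **The `2`-adic lower bound from the record and the five sizes**: `‖Λ₀‖₂ > e^{−U}`.
[cite: Yu1989, §3] -/
theorem norm_Λ₀_gt_of_sizes3 (hℓ1 : P.ℓ = 1) (hy : S.toQ.flat.SizeHyp P.V P.Vθ P.W)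
    (hint : ∀ i, ∃ a : ℤ, S.toQ.all i = a)
    (hind : ∀ κ : Fin (S.d + 1) → ℕ, (∃ j, ¬ 3 ∣ κ j) → ∀ γ : ℚ, ∏ j, S.toQ.all j ^ κ j ≠ γ ^ 3)
    (hDK : ∀ J, J < P.J₀3 → ∀ k, k < S.d → ∀ τ : Tau S.d, tauNorm τ ≤ P.T3 →
      ∀ s₁, s₁ < 3 ^ (k + 1 + J) * P.S₀3 →
        ((S.toQ.Dclear3 (h := P.hparℓ) J P.L3 P.Lθ3 s₁ τ : ℕ) : ℝ) ≤ P.DmaxK3 k)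
    (hMK : ∀ J, J < P.J₀3 → ∀ pv : Idx S.d P.hparℓ P.Lb3 → ℤ,
      (∀ u, |pv u| ≤ ⌈((S.toQ.box3 (h := P.hparℓ) (Lb := P.Lb3) P.L3 P.Lθ3 0).card : ℝ) * P.Amax3⌉) →
      ∀ k, k < S.d → ∀ τ : Tau S.d, tauNorm τ ≤ P.T3 → ∀ s₁, s₁ < 3 ^ (k + 1 + J) * P.S₀3 →
        ¬ 3 ∣ s₁ →
          |(S.toQ.coreSum3 P.J₀3 J (S.toQ.box3 (h := P.hparℓ) (Lb := P.Lb3) P.L3 P.Lθ3 J) pv τ s₁ :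
              ℝ)| ≤ P.MmaxK3 k)
    (hDT : ∀ J, J < P.J₀3 → ∀ s, s < 3 ^ (J + 1) * P.S₀3 → ¬ 3 ∣ s → ∀ τ : Tau S.d,
      tauNorm τ < P.T3 / 3 ^ (J + 1) →
        ((S.toQ.Dclear3 (h := P.hparℓ) J P.L3 P.Lθ3 s τ : ℕ) : ℝ) ≤ P.DmaxT3)
    (hMT : ∀ J, J < P.J₀3 → ∀ s, s < 3 ^ (J + 1) * P.S₀3 → ¬ 3 ∣ s → ∀ τ : Tau S.d,
      tauNorm τ < P.T3 / 3 ^ (J + 1) →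
        ∑ u ∈ S.toQ.box3 (h := P.hparℓ) (Lb := P.Lb3) P.L3 P.Lθ3 J,
          (⌈((S.toQ.box3 (h := P.hparℓ) (Lb := P.Lb3) P.L3 P.Lθ3 0).card : ℝ) * P.Amax3⌉ : ℝ) *
            |((S.toQ.qΔ3 P.J₀3 (J + 1) u τ.1 s * S.frame.qA u τ.2 * S.toQ.qEt u s : ℚ) : ℝ)| ≤
          P.MmaxT3)
    (hA : ∀ s, s < P.S₀3 → ¬ 3 ∣ s → ∀ τ : Tau S.d, tauNorm τ < P.T3 →
      ∀ u ∈ S.toQ.box3 (h := P.hparℓ) (Lb := P.Lb3) P.L3 P.Lθ3 0,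
        |((S.toQ.Dclear3 (h := P.hparℓ) 0 P.L3 P.Lθ3 s τ : ℕ) : ℝ) *
            (S.toQ.qTerm3 P.J₀3 0 u τ s : ℝ)| ≤ P.Amax3) :
    Real.exp (-P.Uℓ) < ‖S.Λ₀‖ :=
  not_le.mp (S.not_norm_Λ₀_le_of_paramPack3
    (S.paramPack3OfSizes P hℓ1 hy hint hind hDK hMK hDT hMT hA))

end TwoSetup

end Summit.ABC.StewartYu

end
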